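import Summits.QuantumFields.YangMills.Theorems.BalabanUVNodesK1EndExactSawtoothLetters

/-!
# THE SAWTOOTH FAMILY INSIDE NODE U2's LETTER CLASS AT `b⋆ = 0` — FILE B: row (iv) FAILS at every level; inside the class the END-exact dial is STRICTLY weaker than K1⁹'s rows
# (port with attribution of ym-nodeO P3 n°100 `SawtoothSeparationAtBstarZero-P3g55.lean` §5–§7, def-free)

Cell `pub-ymgap`, seat `pub-ymgap-dag-n13-w4` (g8), N13 [B16] width seat 4∕4; `--kind proof --supports stmt-QuantumFields-27364 --as helper` (K1⁹
`…Theses.BalabanUVNodes.StabilityBRunRowsAtRecordR13SepCoPHV`, crux r3 DECIDING, route rev 29, skeleton v10).  FILE 6 of this lineage's END-EXACTNESS census; FILE A = `…K1EndExactSawtoothLetters`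
(the teeth, U2's letters with `b⋆ = 0`, (W), (T)).  PORT WITH ATTRIBUTION of P3 n°100 (sha256 ab533756da1f4d30…, g55; REF g65 PASS; evidence row 45 on stmt-QuantumFields-27364) §5–§7;
DEF-FREE (the family is read through `hT`, `hd`, `hβ` and instantiated ONCE, in the headline, as `β k v := −dist(v (Fin.last k), Set.range (j ↦ 2^{-j}))`).

WHAT THIS FILE PROVES (theorems only; 0 `def`):
* §5 `exists_run_saw` — THE RUN FROM `(3∕2)·z`, `z = 2^{-j}`: a solution of (0.20) to every depth, decreasing from its start, window sums telescoping, and `g⁻²` growing by at least `a z∕5`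
  per step while the coupling is still `≥ (6∕5)·z`; hence ★ `no_runPS_saw`: at EVERY level `γ₀ > 0`, for EVERY `M`, an in-window solution with full window sum `< −M` — ROW (iv) of K1⁹
  (`K1R8RowsDefs.RunRowsCont13`'s partial-sum floor) FAILS, although all of U2's letters (with `b⋆ = 0`), rows (i) + (C), (W) and (T) hold (FILE A).
* §6 ★★ `letters_at_bstar_zero_separate_dial_from_rows` — ONE family (the sawtooth, `a = 1`) with history moduli `Λ` such that: U2's modulus on EVERY box, fading at EVERY rate `θ ≥ 0`, NE4 at
  rate ZERO, part 11's property with **`b⋆ = 0`** (constant `C = 1`) at every rate `0 ≤ θ < 1` on every box, rows (i) + (C) at EVERY level, (W) in EVERY window, (T) at EVERY level `≤ 1`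
  with `g⋆(γ) = γ∕2` — and row (iv) FAILING at EVERY level for EVERY `M`; ★ `end_holds_rows_empty_saw` — the same in the two shapes the route reads: the dial's END-exact rows
  {(W), (T), (C)} at `(γ₀, γ′) = (1, 1)` HOLD and K1⁹'s rows-(i)(iv)(C) ∃-shape (`RunRowsCont13`'s text with β abstract) is EMPTY.
* §7 where the separation lives — BELOW THE SIGN: the family is anti-AF signed (`β ≤ 0`, `betaSaw_nonpos`), whereas under the K0-side sign datum `BetaLowerH 0` row (iv) holds for ANY
  family with `M = 0` (`rowIV_of_betaLowerH_zero`; = FILE 4 p634872's `posKick_psFloor` mechanism, stated generically).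
READING (P3 v3.82 item 93, by name in the tree): n°99 priced rows and dial IDENTICALLY by `b⋆` (`≥ 0` necessary, `> 0` sufficient, `= 0` undecided); THIS separates them one step finer,
INSIDE U2's class: the rows' surplus over the dial at `b⋆ = 0` is a SIGN-TYPE datum on `β_θ`.  With FILES 2–4 (outside the class) the census now reads: the END-exact dial is strictly
weaker than K1⁹'s rows both outside and inside the β-flow team's letter class; the surplus is paid by the (D1)∕AF-sign road, never by the END.

HONEST FRAMING.  [folklore] real analysis over the tree's carriers, CONDITIONAL on nothing (the letters are PROVED for the toy family); node U2's letters are HYPOTHESIS SHAPES, NOT printed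
([Balaban1987RG1] p. 298 ∕ p. 264; GAPS G-t4-U2-1∕2); Bałaban's β-functions have no teeth (expected POSITIVE — Thm 2 first sentence — in which regime §7 makes row (iv) free and the whole
rows-vs-dial distinction moot at this abstract level); (T) is proved for slopes `a ≤ 1` only; NOTHING about `Node00.betaOfRecord₁₃` or its `b⋆`; nothing of Bałaban asserted; no item filed ∕
re-keyed (R-30 reserve dial; HARD FREEZE №216); K1⁹ NOT closed (0∕6); N13 NOT discharged; counts UNMOVED (typed 28∕28 · discharged 5∕27 · A 5∕28); R4 = the CONDITIONAL finite-𝕋⁴ rung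
`BalabanLadder.UV` only — the Yang–Mills mass gap (Clay) is NOT proved by any of this; nothing continuum ∕ ℝ⁴ ∕ OS.  No `sorry`, no `axiom`, no `def`, no `instance`, no `notation`.
Sources (locators only): [Balaban1987RG1] (0.20) p. 256, Thm 2 p. 259 (first sentence), §1 pp. 263–264, Thm 3 p. 264, (5.10) p. 293, §5 p. 298; [Balaban1988Convergent] (2.6) p. 255;
[Balaban1989LargeFieldII] Thm 1 + (0.1) pp. 355–356.
-/

noncomputable section

open scoped BigOperators

namespace Summit.QuantumFields.YangMills.Theorems.BalabanUVNodesK1EndExactSawtoothSeparation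

open Finset Filter Topology
open Literature.MathematicalPhysics.QuantumFieldTheory.Balaban1983to89
open Literature.MathematicalPhysics.QuantumFieldTheory.Balaban1983to89.FlowStep (HBeta prefixOf prefixOf_apply Box mem_box RGEqH Y clampPrefix BetaLowerH)
open Literature.MathematicalPhysics.QuantumFieldTheory.Balaban1983to89.T4CouplingMatching (HistLipschitz FadingMemory ScaleShiftRate fadingMemory_diag)
open Literature.MathematicalPhysics.QuantumFieldTheory.Balaban1983to89.T4BetaStationary (betaInf)
open Summit.QuantumFields.YangMills.Theorems.BalabanUVNodesK2NamedJetsRunRemAt (RunConstRemainder SurvCont)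
open Summit.QuantumFields.YangMills.Theorems.BalabanUVNodesK1EndExactSawtoothLetters

variable {T : Set ℝ} {d : ℝ → ℝ} {β : HBeta} {a : ℝ}

/-! ## §5 Row (iv) FAILS at every level: the run from `(3∕2)·z` drops `1∕(4z²)` in `g⁻²`-debt before it passes `(6∕5)·z` — P3 n°100 §5 -/

section RowIVFails

/-- **THE RUN FROM `(3∕2)·z`, `z = 2^{-j}`**: a solution of (0.20) for the sawtooth family to EVERY depth (built from the `g⁻²`-table `y_{n+1} = y_n + a·dist(y_n^{-1∕2}, T)`), decreasing from its
start, with telescoping window sums `Σ_{i<n} β_i = g₀⁻² − g_n⁻²`, whose inverse squared coupling grows by at least `a z∕5` per step as long as the coupling is still `≥ (6∕5)·z` (there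
`dist(g, T) ≥ g − z ≥ z∕5`, FILE A's band lemma). P3 n°100 `exists_run_saw`. [cite: Balaban1987RG1, (0.20) p.256 (the recursion only; elementary)] -/
theorem exists_run_saw (hT : T = Set.range fun j : ℕ => ((1 : ℝ) / 2) ^ j) (hd : ∀ x, d x = Metric.infDist x T)
    (hβ : ∀ (k : ℕ) (v : Fin (k + 1) → ℝ), β k v = -a * d (v (Fin.last k))) (ha : 0 ≤ a) (j : ℕ) :
    ∃ gs : ℕ → ℝ, gs 0 = 3 / 2 * ((1 : ℝ) / 2) ^ j ∧ (∀ n, RGEqH n β gs) ∧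
      (∀ k, 0 < gs k ∧ gs k ≤ 3 / 2 * ((1 : ℝ) / 2) ^ j) ∧
      (∀ n, ∑ i ∈ Ico 0 n, β i (prefixOf gs i) = 1 / (gs 0) ^ 2 - 1 / (gs n) ^ 2) ∧
      ∀ N : ℕ, (∀ n, n ≤ N → 6 / 5 * ((1 : ℝ) / 2) ^ j ≤ gs n) →
        1 / (gs 0) ^ 2 + N * (a * ((1 : ℝ) / 2) ^ j / 5) ≤ 1 / (gs N) ^ 2 := by
  set z : ℝ := ((1 : ℝ) / 2) ^ j with hz
  have hzpos : 0 < z := by rw [hz]; positivity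
  set m : ℝ := 3 / 2 * z with hm
  have hmpos : 0 < m := by rw [hm]; positivity
  obtain ⟨y, hy0, hysucc⟩ : ∃ y : ℕ → ℝ, y 0 = 1 / m ^ 2 ∧ ∀ n, y (n + 1) = y n + a * d (1 / Real.sqrt (y n)) :=
    ⟨fun n => Nat.rec (1 / m ^ 2) (fun _ t => t + a * d (1 / Real.sqrt t)) n, rfl, fun _ => rfl⟩
  have hy0pos : 0 < y 0 := by rw [hy0]; positivity
  have hmono : ∀ n, y 0 ≤ y n ∧ 0 < y n := by
    intro n
    induction n with
    | zero => exact ⟨le_rfl, hy0pos⟩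
    | succ n ih =>
      have hinc : 0 ≤ a * d (1 / Real.sqrt (y n)) := mul_nonneg ha (toothDist_nonneg hd _)
      rw [hysucc]
      exact ⟨by linarith [ih.1], by linarith [ih.2]⟩
  set gs : ℕ → ℝ := fun n => 1 / Real.sqrt (y n) with hgs
  have hgspos : ∀ n, 0 < gs n := fun n => by
    simp only [hgs]; exact one_div_pos.mpr (Real.sqrt_pos.mpr (hmono n).2)
  have hinv : ∀ n, 1 / (gs n) ^ 2 = y n := by
    intro n
    simp only [hgs]
    rw [div_pow, one_pow, Real.sq_sqrt (hmono n).2.le, one_div_one_div]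
  have hsqrt0 : Real.sqrt (y 0) = 1 / m := by
    rw [hy0, show (1 : ℝ) / m ^ 2 = (1 / m) ^ 2 by ring, Real.sqrt_sq (by positivity)]
  have hgs0 : gs 0 = m := by
    simp only [hgs]; rw [hsqrt0, one_div_one_div]
  have hle : ∀ n, gs n ≤ m := by
    intro n
    have h1 : 1 / m ≤ Real.sqrt (y n) := by
      rw [← hsqrt0]; exact Real.sqrt_le_sqrt (hmono n).1
    calc gs n = 1 / Real.sqrt (y n) := rfl
      _ ≤ 1 / (1 / m) := one_div_le_one_div_of_le (by positivity) h1
      _ = m := one_div_one_div m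
  refine ⟨gs, hgs0, ?_, fun k => ⟨hgspos k, hle k⟩, ?_, ?_⟩
  · -- (0.20)
    intro n k _
    rw [hinv, hinv, hysucc, hβ, prefixOf_apply, Fin.val_last]
    simp only [hgs]
    ring
  · -- telescoping
    intro n
    have hsum : ∀ N, ∑ i ∈ Ico 0 N, β i (prefixOf gs i) = y 0 - y N := by
      intro N
      induction N with
      | zero => simp
      | succ N ih =>
        rw [sum_Ico_succ_top (Nat.zero_le N), ih, hysucc, hβ, prefixOf_apply, Fin.val_last]
        simp only [hgs]
        ring
    rw [hsum, hinv, hinv]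
  · -- growth while the coupling is still ≥ (6/5) z
    intro N hge
    have hstep : ∀ n, n < N → y n + a * z / 5 ≤ y (n + 1) := by
      intro n hn
      have h65 : 6 / 5 * z ≤ gs n := hge n hn.le
      have hzle : z ≤ gs n := by linarith
      have hdz : gs n - z ≤ d (gs n) := sub_le_toothDist hT hd hzle (hle n)
      have hd' : z / 5 ≤ d (gs n) := by linarith
      have h1 : a * (z / 5) ≤ a * d (gs n) := mul_le_mul_of_nonneg_left hd' ha
      rw [hysucc]
      have : d (1 / Real.sqrt (y n)) = d (gs n) := rfl
      rw [this]
      linarith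
    have hind : ∀ n, n ≤ N → y 0 + n * (a * z / 5) ≤ y n := by
      intro n
      induction n with
      | zero => intro _; simp
      | succ n ih =>
        intro hn
        have h1 := ih (Nat.le_of_succ_le hn)
        have h2 := hstep n (Nat.lt_of_succ_le hn)
        push_cast
        linarith
    rw [hinv, hinv]
    have := hind N le_rfl
    have e : a * z / 5 = a * ((1 : ℝ) / 2) ^ j / 5 := by rw [hz]
    rw [← e]
    exact this

/-- ★ **NO RUN-WISE PARTIAL-SUM FLOOR AT ANY LEVEL** for the sawtooth family (slope `a > 0`): at every level `γ₀ > 0`, for every `M`, an in-window solution of (0.20) with full window sum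
`< −M` — ROW (iv) of K1⁹ FAILS at every level, although all of U2's letters (with `b⋆ = 0`), rows (i) + (C), (W) and (T) hold (FILE A).  The run from `(3∕2)·z` for a deep tooth `z`
(`(3∕2)z ≤ γ₀`, `4z²·M < 1`) owes `≥ 1∕(4z²)` before it can pass `(6∕5)·z`, and it must pass (linear growth of `g⁻²` while above). P3 n°100 `no_runPS_saw`.
[cite: Balaban1987RG1, (0.20) p.256, Thm 3 p.264, (5.10) p.293; Balaban1988Convergent, (2.6) p.255 (the letter; elementary)] -/
theorem no_runPS_saw (hT : T = Set.range fun j : ℕ => ((1 : ℝ) / 2) ^ j) (hd : ∀ x, d x = Metric.infDist x T)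
    (hβ : ∀ (k : ℕ) (v : Fin (k + 1) → ℝ), β k v = -a * d (v (Fin.last k))) (ha : 0 < a) {γ₀ : ℝ} (hγ₀ : 0 < γ₀) (M : ℝ) :
    ∃ (n : ℕ) (gs : ℕ → ℝ), RGEqH n β gs ∧ Step.InInterval γ₀ n gs ∧ ∑ i ∈ Ico 0 n, β i (prefixOf gs i) < -M := by
  -- a tooth z with (3/2) z ≤ γ₀ and 4 z² |M| < 1
  set ε : ℝ := min (2 * γ₀ / 3) (1 / (4 * (|M| + 1))) with hε
  have hM1 : 0 < |M| + 1 := by positivity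
  have hεpos : 0 < ε := lt_min (by positivity) (by positivity)
  obtain ⟨j, hj⟩ := exists_pow_lt_of_lt_one hεpos (by norm_num : (1 : ℝ) / 2 < 1)
  set z : ℝ := ((1 : ℝ) / 2) ^ j with hz
  have hzpos : 0 < z := by rw [hz]; positivity
  have hzγ : 3 / 2 * z ≤ γ₀ := by
    have : z < 2 * γ₀ / 3 := lt_of_lt_of_le hj (min_le_left _ _)
    linarith
  have hzM : M < 1 / (4 * z ^ 2) := by
    have hz4 : z < 1 / (4 * (|M| + 1)) := lt_of_lt_of_le hj (min_le_right _ _)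
    have hz1 : z ≤ 1 := by
      have : 1 / (4 * (|M| + 1)) ≤ 1 := by
        rw [div_le_one (by positivity)]; nlinarith [abs_nonneg M]
      linarith
    have hzz : z ^ 2 ≤ z := by nlinarith
    have h4 : 4 * z * (|M| + 1) < 1 := by
      have := (lt_div_iff₀ (by positivity : (0 : ℝ) < 4 * (|M| + 1))).mp hz4
      linarith
    rw [lt_div_iff₀ (by positivity)]
    nlinarith [le_abs_self M, abs_nonneg M]
  obtain ⟨gs, hgs0, hrg, hwin, htel, hgrow⟩ := exists_run_saw hT hd hβ ha.le j
  -- the run passes below (6/5) z at some depth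
  have hex : ∃ n, gs n < 6 / 5 * z := by
    by_contra hall
    have hall' : ∀ n, 6 / 5 * z ≤ gs n := fun n => le_of_not_gt (fun h => hall ⟨n, h⟩)
    obtain ⟨N, hN⟩ := exists_nat_gt ((25 / 36 / z ^ 2) / (a * z / 5))
    have hg := hgrow N (fun n _ => hall' n)
    have hinvN : 1 / (gs N) ^ 2 ≤ 25 / 36 / z ^ 2 := by
      have h65 := hall' N
      have hpos : 0 < 6 / 5 * z := by positivity
      calc 1 / (gs N) ^ 2 ≤ 1 / (6 / 5 * z) ^ 2 :=
            one_div_le_one_div_of_le (by positivity) (pow_le_pow_left₀ hpos.le h65 2)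
        _ = 25 / 36 / z ^ 2 := by field_simp; ring
    have h0 : 0 ≤ 1 / (gs 0) ^ 2 := by positivity
    have haz : 0 < a * z / 5 := by positivity
    have hN' : 25 / 36 / z ^ 2 < N * (a * z / 5) := by
      have := (div_lt_iff₀ haz).mp hN
      linarith
    have e : a * ((1 : ℝ) / 2) ^ j / 5 = a * z / 5 := by rw [hz]
    rw [e] at hg
    linarith
  obtain ⟨n, hn⟩ := hex
  refine ⟨n, gs, hrg n, fun k _ => ⟨(hwin k).1, (hwin k).2.trans hzγ⟩, ?_⟩
  rw [htel n, hgs0]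
  have hinvn : 25 / 36 / z ^ 2 < 1 / (gs n) ^ 2 := by
    have hpos := (hwin n).1
    calc 25 / 36 / z ^ 2 = 1 / (6 / 5 * z) ^ 2 := by field_simp; ring
      _ < 1 / (gs n) ^ 2 := one_div_lt_one_div_of_lt (by positivity) (pow_lt_pow_left₀ hn hpos.le two_ne_zero)
  have e1 : 1 / (3 / 2 * ((1 : ℝ) / 2) ^ j) ^ 2 = 4 / 9 / z ^ 2 := by rw [← hz]; field_simp; ring
  rw [e1]
  have e2 : 4 / 9 / z ^ 2 - 25 / 36 / z ^ 2 = -(1 / (4 * z ^ 2)) := by field_simp; ring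
  have : 4 / 9 / z ^ 2 - 1 / (gs n) ^ 2 < -(1 / (4 * z ^ 2)) := by linarith
  linarith

end RowIVFails

/-! ## §6 Headline: inside U2's letter class, at `b⋆ = 0`, the dial's END-exact rows hold and K1⁹'s rows are empty — P3 n°100 §6 -/

section Headline

/-- ★★ **THE LETTERS WITH `b⋆ = 0` SEPARATE THE DIAL FROM THE ROWS — KERNEL WITNESS INSIDE NODE U2's CLASS.**  There is a family `β` (the sawtooth `β_{k+1}(g_{≤k}) = −dist(g_k, {2^{-j}})`,
slope `a = 1`, instantiated here once) with history moduli `Λ` and a constant `a > 0` such that: node U2's modulus holds on EVERY box, the moduli fade at EVERY rate `θ ≥ 0`, NE4 holds at rate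
ZERO, part 11's asymptotic constant is **`b⋆ = 0`** (constant `C = a`) at every rate `0 ≤ θ < 1` on every box, rows (i) (constant-history remainder) and (C) hold at EVERY level, **(W) holds in
EVERY window and (T) at EVERY level `≤ 1` with `g⋆(γ) = γ∕2`** — and ROW (iv) FAILS at EVERY level for EVERY `M`.  Compare the β-flow team's part 12c `bstar_pos_loadBearing` (same letters,
`negLin`: there (T) fails too, P3 n°99 §4) — here the dial's END survives while the rows die: STRICT separation INSIDE the letter class, at exactly the cell `b⋆ = 0` that n°99 leaves open.
P3 n°100 `letters_at_bstar_zero_separate_dial_from_rows`, PORTED WITH ATTRIBUTION. [folklore] -/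
theorem letters_at_bstar_zero_separate_dial_from_rows :
    ∃ (β : HBeta) (Λ : ℕ → ℕ → ℝ) (a : ℝ), 0 < a ∧
      (∀ γ : ℝ, HistLipschitz Λ γ β) ∧ (∀ θ : ℝ, 0 ≤ θ → FadingMemory a θ Λ) ∧ (∀ θ γ : ℝ, ScaleShiftRate 0 θ γ β) ∧
      (∀ θ γ : ℝ, 0 ≤ θ → θ < 1 → ∀ u : ℝ, 0 < u → u ≤ γ → |betaInf β (fun _ : ℕ => u) - 0| ≤ a * u / (1 - θ)) ∧
      (∀ θ γ₀ : ℝ, 0 ≤ θ → θ < 1 → 0 < γ₀ →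
        (∀ (n : ℕ) (gs : ℕ → ℝ), RGEqH n β gs → Step.InInterval γ₀ n gs →
            ∀ k, k ≤ n → |β k (prefixOf gs k) - β k (fun _ : Fin (k + 1) => γ₀)| ≤ a * γ₀ / (1 - θ)) ∧
          SurvCont β γ₀) ∧
      (∀ γ : ℝ, 0 < γ → ∀ K : ℕ, ∃ gs : ℕ → ℝ, RGEqH K β gs ∧ Step.InInterval γ K gs) ∧
      (∀ γ : ℝ, 0 < γ → γ ≤ 1 → ∃ gstar : ℝ, 0 < gstar ∧
        ∀ (n : ℕ) (gs : ℕ → ℝ), RGEqH n β gs → Step.InInterval γ n gs → ∀ k, k ≤ n → gs k = γ → gstar ≤ gs n) ∧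
      ∀ γ₀ : ℝ, 0 < γ₀ → ∀ M : ℝ, ∃ (n : ℕ) (gs : ℕ → ℝ), RGEqH n β gs ∧ Step.InInterval γ₀ n gs ∧
        ∑ i ∈ Ico 0 n, β i (prefixOf gs i) < -M := by
  -- the instance: T = dyadic teeth, d = dist(·, T), β = the sawtooth with slope 1 (introduced as opaque witnesses with their defining equations)
  obtain ⟨T, hT⟩ : ∃ T : Set ℝ, T = Set.range fun j : ℕ => ((1 : ℝ) / 2) ^ j := ⟨_, rfl⟩
  obtain ⟨d, hd⟩ : ∃ d : ℝ → ℝ, ∀ x, d x = Metric.infDist x T := ⟨fun x => Metric.infDist x T, fun _ => rfl⟩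
  obtain ⟨β, hβ⟩ : ∃ β : HBeta, ∀ (k : ℕ) (v : Fin (k + 1) → ℝ), β k v = -(1 : ℝ) * d (v (Fin.last k)) :=
    ⟨fun k v => -(1 : ℝ) * d (v (Fin.last k)), fun _ _ => rfl⟩
  exact ⟨β, fun k i => if i = k then (1 : ℝ) else 0, 1, one_pos,
    fun γ => histLipschitz_saw hd hβ zero_le_one γ, fun _ hθ => fadingMemory_diag zero_le_one hθ, fun θ γ => scaleShiftRate_saw hβ θ γ,
    fun _ γ hθ0 hθ1 => bstar_zero_saw hT hd hβ zero_le_one hθ0 hθ1 γ, fun _ _ hθ0 hθ1 hγ₀ => rowI_and_C_saw hd hβ zero_le_one hθ0 hθ1 hγ₀,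
    fun _ hγ K => constRun_saw hT hd hβ hγ K, topRunsFamily_saw hT hd hβ zero_le_one le_rfl,
    fun _ hγ₀ M => no_runPS_saw hT hd hβ one_pos hγ₀ M⟩

/-- ★ **THE SAME, IN THE TWO SHAPES THE ROUTE READS** (β abstract in place of `β_θ`; any sawtooth instance read through `hT`, `hd`, `hβ` with slope `0 < a ≤ 1`): the dial's END-EXACT rows
`(W) ∧ (T) ∧ (C)` (P3 n°95 :809 ∕ my p633163's inline text, with `(γ₀, γ′) = (1, 1)`) HOLD, and K1⁹'s rows-(i)(iv)(C) ∃-shape (`K1R8RowsDefs.RunRowsCont13`'s text with β in place of `β_θ`)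
is EMPTY — no `b r γ₀ M` whatsoever.  P3 n°100 `end_holds_rows_empty_saw`, PORTED WITH ATTRIBUTION. [folklore] -/
theorem end_holds_rows_empty_saw (hT : T = Set.range fun j : ℕ => ((1 : ℝ) / 2) ^ j) (hd : ∀ x, d x = Metric.infDist x T)
    (hβ : ∀ (k : ℕ) (v : Fin (k + 1) → ℝ), β k v = -a * d (v (Fin.last k))) (ha : 0 < a) (ha1 : a ≤ 1) :
    ((∀ γ : ℝ, 0 < γ → γ ≤ 1 → ∀ K : ℕ, ∃ gs : ℕ → ℝ, RGEqH K β gs ∧ Step.InInterval γ K gs) ∧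
        (∀ γ : ℝ, 0 < γ → γ ≤ 1 → ∃ gstar : ℝ, 0 < gstar ∧
          ∀ (n : ℕ) (gs : ℕ → ℝ), RGEqH n β gs → Step.InInterval γ n gs → ∀ k, k ≤ n → gs k = γ → gstar ≤ gs n) ∧
        SurvCont β 1) ∧
      ¬ ∃ (b : ℕ → ℝ) (r γ₀ M : ℝ), 0 < γ₀ ∧ RunConstRemainder β b r γ₀ ∧
          (∀ (n : ℕ) (gs : ℕ → ℝ), RGEqH n β gs → Step.InInterval γ₀ n gs →
            ∀ k, k ≤ n → -M ≤ ∑ i ∈ Ico k n, β i (prefixOf gs i)) ∧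
          SurvCont β γ₀ := by
  refine ⟨⟨fun γ hγ _ K => constRun_saw hT hd hβ hγ K, topRunsFamily_saw hT hd hβ ha.le ha1,
    (rowI_and_C_saw hd hβ ha.le (θ := 0) (γ₀ := 1) le_rfl zero_lt_one one_pos).2⟩, ?_⟩
  rintro ⟨b, r, γ₀, M, hγ₀, _, hiv, _⟩
  obtain ⟨n, gs, hrg, hI, hlt⟩ := no_runPS_saw hT hd hβ ha hγ₀ M
  have h := hiv n gs hrg hI 0 (Nat.zero_le n)
  linarith

end Headline

/-! ## §7 Where the separation lives: below the sign — P3 n°100 §7 -/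

section BelowTheSign

/-- the sawtooth family has the ANTI-AF sign: `β ≤ 0` everywhere (zero exactly on the teeth). P3 n°100 `betaSaw_nonpos`. [folklore] -/
theorem betaSaw_nonpos (hd : ∀ x, d x = Metric.infDist x T) (hβ : ∀ (k : ℕ) (v : Fin (k + 1) → ℝ), β k v = -a * d (v (Fin.last k))) (ha : 0 ≤ a)
    (k : ℕ) (v : Fin (k + 1) → ℝ) : β k v ≤ 0 := by
  rw [hβ, neg_mul, neg_nonpos]
  exact mul_nonneg ha (toothDist_nonneg hd _)

/-- … whereas under the SIGN datum `0 ≤ β` on the box (`FlowStep.BetaLowerH 0 γ₀ β`, the K0-side letter) ROW (iv) holds for ANY family with `M = 0` — window sums of non-negative terms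
(FILE 4 p634872's `posKick_psFloor` mechanism, stated for every floor-0 family).  So, inside U2's letter class, row (iv)'s price is a sign-type datum which the dial's END does not pay (§6)
and which no letter with `b⋆ = 0` supplies. P3 n°100 `rowIV_of_betaLowerH_zero`. [cite: Balaban1987RG1, (0.20) p.256; Balaban1988Convergent, (2.6) p.255 (the letter; elementary)] -/
theorem rowIV_of_betaLowerH_zero {β : HBeta} {γ₀ : ℝ} (hb : BetaLowerH 0 γ₀ β) :
    ∀ (n : ℕ) (gs : ℕ → ℝ), RGEqH n β gs → Step.InInterval γ₀ n gs →
      ∀ k, k ≤ n → -(0 : ℝ) ≤ ∑ i ∈ Ico k n, β i (prefixOf gs i) := by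
  intro n gs _ hI k _
  rw [neg_zero]
  refine sum_nonneg fun i hi => hb i (prefixOf gs i) (mem_box.mpr fun l => ?_)
  have hin : i < n := (mem_Ico.mp hi).2
  exact hI l ((Nat.le_of_lt_succ l.isLt).trans hin.le)

end BelowTheSign

end Summit.QuantumFields.YangMills.Theorems.BalabanUVNodesK1EndExactSawtoothSeparation

end
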